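import Mathlib.AlgebraicGeometry.EllipticCurve.LFunction
import Literature.NumberTheory.Automorphic.BrandtXi
import HarnessLib

/-!
# The definite quaternionic self-pairing `ξ(E; N⁺, N⁻)` of an elliptic curve over `ℚ`

Requested by route `ABC/QuaternionicDegree` (crux `DegreeBoundModComponents`, planned child
`XiBound`; definition item `defn-BrandtModuleJLSelfPairing`).

For an elliptic curve `E/ℚ` given by a Weierstrass model `W` and a factorisation type `(N⁺, N⁻)`,
`BrandtModuleJLSelfPairing W N⁺ N⁻ ∈ ℕ` is the self-pairing

  `ξ(E; N⁺, N⁻) = ⟨φ_E, φ_E⟩ = Σ_i w_i φ_E(I_i)²`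

of the primitive integral generator `φ_E` of the `a(E)`-eigen-line — the Jacquet–Langlands
(Eichler) transfer of the newform `f_E` — in the Brandt module `ℤ[Cls O] = Pic(X_{N⁺,N⁻})` of an
Eichler order `O` of level `N⁺` in the definite quaternion algebra over `ℚ` of discriminant `N⁻`,
for Gross's height pairing `⟨e_i, e_j⟩ = w_i δ_ij`, `w_i = #O_L(I_i)ˣ / 2` (Gross 1987 §§1–4).
This is the number `ξ_f(N⁺, N⁻) = ⟨g_f, g_f⟩` of Pollack–Weston 2011, §2.1 (there `ℳ = Pic ⊗ ℤ_p`,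
`ℳ^f` is free of rank one over `𝒪` with generator `g_f`, defined up to a `p`-adic unit; the
primitive integral generator gives the integer whose `p`-adic valuations are theirs for every `p`).

All the quaternionic content (Eichler orders, class sets, Brandt matrices `T(n)`, weights `w_i`,
the eigen-lattice, `ξ` of a line, setups `Brandt.XiSetup N⁺ N⁻`, the datum-free `brandtXi`) is
the tree file `Literature.NumberTheory.Automorphic.BrandtXi`; this file only specialises the
eigenvalue system to `n ↦ a_n(E)`, the coefficients of Mathlib's `WeierstrassCurve.LFunction`
(Euler product of the local factors of local minimal models: `a_p = p + 1 - #Ẽ(𝔽_p)` at good `p`).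
Only the values `a_p`, `p` prime, `p ∤ N⁺N⁻`, enter (`Brandt.eigenLattice`).

Typical use: `E` semistable of conductor `N`, `q ∣ N` prime, `ξ(E; N/q, q) =
BrandtModuleJLSelfPairing W (N / q) q`; by Jacquet–Langlands and strong multiplicity one the
`a(E)`-eigen-lattice is then a line, so the value is the honest `Σ_i w_i φ_i²`
(`xi_lFunction_eq_sum`).  Upper bounds are proved setup by setup
(`brandtModuleJLSelfPairing_le_of_forall`), which needs no independence-of-choices theorem.

Junk values (inherited from `brandtXi`): `0` if there is no setup of type `(N⁺, N⁻)` (`N⁻` not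
squarefree or with an even number of prime factors, `N⁺ = 0`, `gcd(N⁺, N⁻) ≠ 1`) or if the
`a(E)`-eigen-lattice of the chosen setup is not a line (e.g. `N⁺N⁻` is not the conductor of `E`);
the setup is chosen by `Classical.choice` inside `brandtXi`.

NOT here: the identity `ord_ℓ η_f(N) = ord_ℓ ξ(E; N/q, q) + ord_ℓ(ord_q Δ_min(E))` (Pollack–Weston
2011 Thm. 6.8 with Ribet–Takahashi 1997 and Böckle–Khare–Manning 2021), a separate fact item.

## References

* R. Pollack, T. Weston, *On anticyclotomic μ-invariants of modular forms*, Compos. Math. 147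
  (2011) 1353–1381, §2.1 (`ξ_f(N⁺,N⁻) = ⟨g_f, g_f⟩`), Thm. 6.8.
* B. H. Gross, *Heights and the special values of L-series*, CMS Conf. Proc. 7 (1987) 115–187,
  §§1–4.
* J. Voight, *Quaternion Algebras*, GTM 288 (2021), §41.1 (Brandt matrices, `w_i`).
-/

noncomputable section

namespace Literature.NumberTheory.EllipticCurves

open Literature.NumberTheory.Automorphic

/-- **`ξ(E; N⁺, N⁻)`**, the Brandt-module (Jacquet–Langlands) self-pairing of the elliptic curve
with Weierstrass model `W`: `⟨φ_E, φ_E⟩ = Σ_i w_i φ_E(I_i)² ∈ ℕ`, where `φ_E` is a generator of the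
common eigen-lattice `{v ∈ ℤ^{Cls O} : T(p) v = a_p(E) v for all primes p ∤ N⁺N⁻}` of the Brandt
matrices of an Eichler order `O` of level `N⁺` in the definite quaternion algebra over `ℚ` of
discriminant `N⁻` (when that lattice is a line; `0` otherwise) and `w_i = #O_L(I_i)ˣ / 2` — the
number `ξ_f(N⁺, N⁻) = ⟨g_f, g_f⟩` of Pollack–Weston for `f = f_E` (Gross's pairing
`⟨e_i, e_j⟩ = w_i δ_ij` on `Pic(X_{N⁺,N⁻}) = ℤ[Cls O]`).  By definition
`brandtXi N⁺ N⁻ (n ↦ a_n(E))` with `a_n(E)` the `n`-th coefficient of Mathlib's `W.LFunction`;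
the (upper-camel) name is the notion filed by route `ABC/QuaternionicDegree`.  Junk `0` without a
setup of type `(N⁺, N⁻)` or off rank one (module docstring).
[cite: PollackWeston2011, §2.1] -/
def BrandtModuleJLSelfPairing (W : WeierstrassCurve ℚ) (Nplus Nminus : ℕ) : ℕ :=
  brandtXi Nplus Nminus fun n => W.LFunction n

variable (W : WeierstrassCurve ℚ) {Nplus Nminus : ℕ}

/-- `ξ(E; N⁺, N⁻) = brandtXi N⁺ N⁻ (n ↦ a_n(E))` (definitional). [folklore] -/
theorem brandtModuleJLSelfPairing_def (Nplus Nminus : ℕ) :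
    BrandtModuleJLSelfPairing W Nplus Nminus = brandtXi Nplus Nminus fun n => W.LFunction n :=
  rfl

/-- `ξ(E; N⁺, N⁻)` is the `ξ` of the setup chosen by `brandtXi` (when a setup exists). [folklore] -/
theorem brandtModuleJLSelfPairing_eq_xi (h : Nonempty (Brandt.XiSetup Nplus Nminus)) :
    BrandtModuleJLSelfPairing W Nplus Nminus = (Classical.choice h).xi fun n => W.LFunction n :=
  brandtXi_eq_xi h _

/-- `ξ(E; N⁺, N⁻)` is realised by some setup of type `(N⁺, N⁻)` whenever one exists. [folklore] -/
theorem exists_brandtModuleJLSelfPairing_eq (h : Nonempty (Brandt.XiSetup Nplus Nminus)) :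
    ∃ S : Brandt.XiSetup Nplus Nminus,
      BrandtModuleJLSelfPairing W Nplus Nminus = S.xi fun n => W.LFunction n :=
  exists_brandtXi_eq h _

/-- Without a setup of type `(N⁺, N⁻)` (e.g. `N⁻` divisible by an even number of primes) the value
is the junk `0`. [folklore] -/
theorem brandtModuleJLSelfPairing_of_isEmpty (h : IsEmpty (Brandt.XiSetup Nplus Nminus)) :
    BrandtModuleJLSelfPairing W Nplus Nminus = 0 :=
  brandtXi_of_isEmpty h _

/-- No setup has a non-squarefree `N⁻` (the discriminant of a quaternion algebra over `ℚ` is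
squarefree), so there the value is the junk `0`. [folklore] -/
theorem brandtModuleJLSelfPairing_of_not_squarefree (h : ¬ Squarefree Nminus) :
    BrandtModuleJLSelfPairing W Nplus Nminus = 0 :=
  brandtModuleJLSelfPairing_of_isEmpty W ⟨fun S => h S.squarefree⟩

/-- **Bounding `ξ(E; N⁺, N⁻)` setup by setup**: an upper bound for `Σ_i w_i φ_i²` valid in every
setup of type `(N⁺, N⁻)` bounds `ξ(E; N⁺, N⁻)` (the form needed for `XiBound`; no
independence-of-choices theorem is required). [folklore] -/
theorem brandtModuleJLSelfPairing_le_of_forall {B : ℕ}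
    (h : ∀ S : Brandt.XiSetup Nplus Nminus, S.xi (fun n => W.LFunction n) ≤ B) :
    BrandtModuleJLSelfPairing W Nplus Nminus ≤ B :=
  brandtXi_le_of_forall h

/-- A lower bound valid in every setup bounds `ξ(E; N⁺, N⁻)` from below, provided a setup
exists. [folklore] -/
theorem le_brandtModuleJLSelfPairing_of_forall {B : ℕ}
    (hne : Nonempty (Brandt.XiSetup Nplus Nminus))
    (h : ∀ S : Brandt.XiSetup Nplus Nminus, B ≤ S.xi fun n => W.LFunction n) :
    B ≤ BrandtModuleJLSelfPairing W Nplus Nminus :=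
  le_brandtXi_of_forall hne h

/-- **The formula `ξ = Σ_i w_i φ_i²`** in a setup `S = (D, O)`: if the common eigen-lattice of the
Brandt matrices `T(p)` (`p ∤ N⁺N⁻`) for the eigenvalues `a_p(E)` is the line `ℤ φ` (`φ ≠ 0`; this
is the Jacquet–Langlands / multiplicity-one situation, `N⁺N⁻` the conductor of `E`), then
`S.xi (a(E)) = Σ_i w_i |φ_i|²` for any enumeration (`Fintype` structure) of the finite class set
(Pollack–Weston 2011 §2.1, `ξ_f = ⟨g_f, g_f⟩` with `⟨e_i, e_j⟩ = w_i δ_ij`).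
[cite: PollackWeston2011, §2.1] -/
theorem xi_lFunction_eq_sum (S : Brandt.XiSetup Nplus Nminus) [Fintype (Brandt.ClassSet S.O)]
    {φ : Brandt.ClassSet S.O → ℤ} (hφ : φ ≠ 0)
    (hL : Brandt.eigenLattice (Nplus * Nminus) (Brandt.matrix S.O) (fun n => W.LFunction n) =
      ℤ ∙ φ) :
    S.xi (fun n => W.LFunction n) = ∑ i, Brandt.weight S.O i * (φ i).natAbs ^ 2 := by
  rw [Brandt.XiSetup.xi, Brandt.xiOfOrder_eq, Brandt.xi_eq_sum _ hφ hL]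

/-- In the multiplicity-one situation of `xi_lFunction_eq_sum`, holding in every setup with a
uniform bound `Σ_i w_i φ_i² ≤ B` on the primitive eigenvector, `ξ(E; N⁺, N⁻) ≤ B`. [folklore] -/
theorem brandtModuleJLSelfPairing_le_of_forall_eigenvector {B : ℕ}
    (h : ∀ (S : Brandt.XiSetup Nplus Nminus) [Fintype (Brandt.ClassSet S.O)]
      (φ : Brandt.ClassSet S.O → ℤ), φ ≠ 0 →
      Brandt.eigenLattice (Nplus * Nminus) (Brandt.matrix S.O) (fun n => W.LFunction n) = ℤ ∙ φ →
      ∑ i, Brandt.weight S.O i * (φ i).natAbs ^ 2 ≤ B) :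
    BrandtModuleJLSelfPairing W Nplus Nminus ≤ B := by
  classical
  refine brandtModuleJLSelfPairing_le_of_forall W fun S => ?_
  letI : Fintype (Brandt.ClassSet S.O) := Fintype.ofFinite _
  by_cases hline : ∃ φ : Brandt.ClassSet S.O → ℤ, φ ≠ 0 ∧
      Brandt.eigenLattice (Nplus * Nminus) (Brandt.matrix S.O) (fun n => W.LFunction n) = ℤ ∙ φ
  · obtain ⟨φ, hφ, hL⟩ := hline
    rw [xi_lFunction_eq_sum W S hφ hL]
    exact h S φ hφ hL
  · rw [Brandt.XiSetup.xi, Brandt.xiOfOrder_eq, Brandt.xi_of_not_isLine _ hline]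
    exact Nat.zero_le _

end Literature.NumberTheory.EllipticCurves
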